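import Summits.Ventures.YMGap.RobustBall.BoundaryFreeEnergyDim
import Summits.Ventures.YMGap.RobustBall.BoundaryFreeEnergyBoxes
import HarnessLib

/-!
# Venture YMGap, track ROBUST-BALL — «C-DS-I» ON CUBES IN EVERY DIMENSION: van Hove's theorem with ARBITRARY boundary conditions,
# quantitative and boundary-uniform, for `SU(N)` lattice Yang–Mills on `ℤ^d`, every `N ≥ 2`, every `d ≥ 2`

HONEST FRAMING. WHAT THIS IS: a venture file (cell `pub-ymgap`, track Y2 ROBUST-BALL / DS, seat ds-3, theorems only, 0 compute): the every-`N`,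
every-`d` cube cell of «C-DS-I» (`BoundaryFreeEnergyDim.suN_abs_log_normaliser_sub_freeEnergy_le` with the canonical depth `M − ‖base p‖_∞` of the
link volume `Λ_M = boxLinks d M`, plus the counting of `BoundaryFreeEnergyBoxes` in dimension `d`):
* `siteBox_product_subset_plaquettesTouching_dim` (`#T(Λ_M) ≥ #planes(d)·(2M+1)^d`), `plaquettesTouching_boxLinks_subset_dim`
  (`T(Λ_M) ⊆ siteBox d (M+1) × planes`), `card_shallow_le_dim`;
* ★★ `suN_abs_log_normaliser_box_div_sub_le_dim` — `SU(N)`, `d ≥ 2`, 't Hooft ρ-window (`β ≤ 1/(12(d−1))`, `β < 1/(8d)`,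
  `6(d−1)β/(½ − 2(d−1)β) ≤ ρ < 1`, i.e. `β < 1/(16(d−1))`), every `M`, every `K ≤ M`, EVERY boundary field `η`:
  `|log Z_{Λ_M}(Nβ|η)/#T(Λ_M) − f(Nβ)/#planes(d)| ≤ Nβ·(32N⁴√N·max(ρ,½)^K + 2N·((2M+3)^d − (2(M−K)+1)^d)/(2M+1)^d)` — the free energy per
  plaquette of a cube with ANY frozen boundary links converges to the infinite-volume free energy per plaquette `f/#planes`, uniformly in the
  boundary field, in every dimension (in particular `d = 3`), HYPOTHESIS-FREE.
WHAT THIS IS NOT: lattice strong coupling; rates are Dobrushin-comparison artefacts; nothing continuum / Clay. Everything here is proved. [folklore]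
-/

noncomputable section

open MeasureTheory ProbabilityTheory Filter Topology Real Finset Set
open scoped NNReal
open Literature.Probability.LatticeModels hiding configShift configShift_apply
open Literature.MathematicalPhysics.QuantumLattice
open Literature.MathematicalPhysics.QuantumFieldTheory (haarProbability)

namespace Summit.Ventures.YMGap.RobustBall

namespace BoundaryFreeEnergy

variable {d N : ℕ}

/-- Every plaquette based in the cube touches the cube's links: `siteBox d M × planes ⊆ T(Λ_M)`. [folklore] -/
theorem siteBox_product_subset_plaquettesTouching_dim (M : ℕ) :
    (siteBox d M) ×ˢ (Finset.univ : Finset {q : Fin d × Fin d // q.1 < q.2}) ⊆ plaquettesTouching (boxLinks d M) := by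
  intro p hp
  rw [Finset.mem_product] at hp
  rw [mem_plaquettesTouching_iff]
  refine ⟨(p.1, p.2.1.1), Finset.mem_inter.2 ⟨by simp [plaquetteEdges], ?_⟩⟩
  rw [mem_boxLinks]; exact hp.1

/-- Every plaquette touching the cube's links is based in the cube of radius `M + 1`. [folklore] -/
theorem plaquettesTouching_boxLinks_subset_dim (M : ℕ) :
    plaquettesTouching (boxLinks d M) ⊆ (siteBox d (M + 1)) ×ˢ (Finset.univ : Finset {q : Fin d × Fin d // q.1 < q.2}) := by
  intro p hp
  rw [mem_plaquettesTouching_iff] at hp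
  obtain ⟨x, hx⟩ := hp
  obtain ⟨hxp, hxΛ⟩ := Finset.mem_inter.1 hx
  rw [mem_boxLinks, mem_siteBox_iff_norm] at hxΛ
  rw [Finset.mem_product]
  refine ⟨mem_siteBox_of_norm_lt ?_, Finset.mem_univ _⟩
  have h := norm_fst_le_norm_add_one_of_mem_plaquetteEdges hxp
  push_cast; linarith

/-- The shallow plaquettes (base point farther than `M − K` from the origin) number at most `#planes(d)·((2M+3)^d − (2(M−K)+1)^d)`, `K ≤ M`.
[folklore] -/
theorem card_shallow_le_dim {M K : ℕ} (hK : K ≤ M) :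
    (((plaquettesTouching (boxLinks d M)).filter fun p => ((M : ℝ) - K) < ‖p.1‖).card : ℝ) ≤
      (Fintype.card {q : Fin d × Fin d // q.1 < q.2} : ℝ) * ((2 * (M : ℝ) + 3) ^ d - (2 * ((M : ℝ) - K) + 1) ^ d) := by
  classical
  have hsub : ((plaquettesTouching (boxLinks d M)).filter fun p => ((M : ℝ) - K) < ‖p.1‖) ⊆
      (siteBox d (M + 1) \ siteBox d (M - K)) ×ˢ (Finset.univ : Finset {q : Fin d × Fin d // q.1 < q.2}) := by
    intro p hp
    obtain ⟨hpT, hpn⟩ := Finset.mem_filter.1 hp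
    have h1 := Finset.mem_product.1 (plaquettesTouching_boxLinks_subset_dim M hpT)
    rw [Finset.mem_product, Finset.mem_sdiff]
    refine ⟨⟨h1.1, fun h2 => ?_⟩, Finset.mem_univ _⟩
    rw [mem_siteBox_iff_norm, Nat.cast_sub hK] at h2
    linarith
  have hcard := Finset.card_le_card hsub
  rw [Finset.card_product, Finset.card_sdiff_of_subset (ThermodynamicVariance.siteBox_mono (by omega)),
    ThermodynamicVariance.card_siteBox, ThermodynamicVariance.card_siteBox, Finset.card_univ] at hcard
  have hpow : (2 * (M - K) + 1) ^ d ≤ (2 * (M + 1) + 1) ^ d := Nat.pow_le_pow_left (by omega) d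
  have h : ((((2 * (M + 1) + 1) ^ d - (2 * (M - K) + 1) ^ d) * Fintype.card {q : Fin d × Fin d // q.1 < q.2} : ℕ) : ℝ) =
      (Fintype.card {q : Fin d × Fin d // q.1 < q.2} : ℝ) * ((2 * (M : ℝ) + 3) ^ d - (2 * ((M : ℝ) - K) + 1) ^ d) := by
    rw [Nat.cast_mul, Nat.cast_sub hpow]
    push_cast
    rw [Nat.cast_sub hK]
    ring
  rw [← h]
  exact_mod_cast hcard

/-- ★★ **VAN HOVE WITH ARBITRARY BOUNDARY CONDITIONS IN EVERY DIMENSION, QUANTITATIVE AND BOUNDARY-UNIFORM** (`SU(N)`, `N ≥ 2`, `d ≥ 2`, Wilson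
action, 't Hooft `0 ≤ β ≤ 1/(12(d−1))`, `β < 1/(8d)`, ratio `6(d−1)β/(½ − 2(d−1)β) ≤ ρ < 1` — i.e. the ρ-window `β < 1/(16(d−1))`): for every
cube radius `M`, every `K ≤ M` and EVERY boundary field `η` on `Λ_M = boxLinks d M`,
`|log Z_{Λ_M}(Nβ|η)/#T(Λ_M) − f(Nβ)/#planes(d)| ≤ Nβ·(32N⁴√N·max(ρ,½)^K + 2N·((2M+3)^d − (2(M−K)+1)^d)/(2M+1)^d)`. [folklore] -/
theorem suN_abs_log_normaliser_box_div_sub_le_dim (hd : 2 ≤ d) (hN : 2 ≤ N) {β ρ : ℝ} (hβ0 : 0 ≤ β)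
    (hβ : β ≤ 1 / (12 * ((d : ℝ) - 1))) (hβ' : β < 1 / (8 * (d : ℝ)))
    (hρ : 6 * ((d : ℝ) - 1) * β / (1 / 2 - β * (2 * ((d : ℝ) - 1))) ≤ ρ) (hρ1 : ρ < 1) {M K : ℕ} (hK : K ≤ M)
    (η : LGConfig d (SUN N)) :
    |Real.log (∫ ζ, Real.exp (-(N * β) * wilsonBoundaryAction (fundamentalRep (Fin N)) (boxLinks d M) (glueWith (boxLinks d M) ζ η))
          ∂(Measure.pi fun _ : ↥(boxLinks d M) => haarProbability (SUN N))) / (plaquettesTouching (boxLinks d M)).card -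
        freeEnergyDensity d (fundamentalRep (Fin N)) (N * β) / (Fintype.card {q : Fin d × Fin d // q.1 < q.2} : ℝ)| ≤
      N * β * (32 * (N : ℝ) ^ 4 * Real.sqrt N * (max ρ (1 / 2)) ^ K +
        2 * N * (((2 * (M : ℝ) + 3) ^ d - (2 * ((M : ℝ) - K) + 1) ^ d) / (2 * (M : ℝ) + 1) ^ d)) := by
  classical
  set T := plaquettesTouching (boxLinks d M) with hT
  set np : ℝ := (Fintype.card {q : Fin d × Fin d // q.1 < q.2} : ℝ) with hnp
  set θ : ℝ := max ρ (1 / 2) with hθ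
  set C : ℝ := 32 * (N : ℝ) ^ 4 * Real.sqrt N with hC
  have hC0 : 0 ≤ C := by positivity
  have hθ0 : 0 ≤ θ := le_max_of_le_right (by norm_num)
  have hθ1 : θ ≤ 1 := max_le hρ1.le (by norm_num)
  have hNβ : 0 ≤ (N : ℝ) * β := by positivity
  -- the number of planes is positive (`d ≥ 2`)
  have hnp0 : 0 < np := by
    have : Nonempty {q : Fin d × Fin d // q.1 < q.2} := ⟨⟨(⟨0, by omega⟩, ⟨1, by omega⟩), by simp [Fin.lt_def]⟩⟩
    rw [hnp]; exact_mod_cast Fintype.card_pos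
  -- the volume: `np·(2M+1)^d ≤ #T`
  have hTge : np * (2 * (M : ℝ) + 1) ^ d ≤ (T.card : ℝ) := by
    have h := Finset.card_le_card (siteBox_product_subset_plaquettesTouching_dim (d := d) M)
    rw [Finset.card_product, ThermodynamicVariance.card_siteBox, Finset.card_univ] at h
    have h' : (((2 * M + 1) ^ d * Fintype.card {q : Fin d × Fin d // q.1 < q.2} : ℕ) : ℝ) ≤ (T.card : ℝ) := by exact_mod_cast h
    push_cast at h'
    rw [hnp]; linarith
  have hV0 : (0 : ℝ) < np * (2 * (M : ℝ) + 1) ^ d := by positivity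
  have hTpos : (0 : ℝ) < (T.card : ℝ) := hV0.trans_le hTge
  -- «C-DS-I» every N, every d, with the canonical depth `M − ‖base p‖`
  have hmain := suN_abs_log_normaliser_sub_freeEnergy_le hd hN hβ0 hβ hβ' hρ hρ1 (boxLinks d M) η (fun p => (M : ℝ) - ‖p.1‖)
    (fun p _ y hy z hz => by
      have h1 := norm_fst_le_of_mem_plaquetteEdges hy
      have h3 : ‖z.1‖ ≤ ‖y.1‖ + ‖y.1 - z.1‖ := by
        have := norm_le_norm_add_norm_sub' z.1 y.1
        rw [norm_sub_rev] at this; linarith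
      have h4 : (M : ℝ) + 1 ≤ ‖z.1‖ := by
        refine le_of_not_gt fun h5 => hz ?_
        rw [mem_boxLinks]; exact mem_siteBox_of_norm_lt h5
      show (M : ℝ) - ‖p.1‖ ≤ ‖y.1 - z.1‖
      linarith)
  -- the surface sum, split into deep and shallow plaquettes
  set g : ZdPlaquette d → ℝ := fun p => min (2 * (N : ℝ)) (C * θ ^ ⌊(M : ℝ) - ‖p.1‖⌋₊) with hg
  have hsplit : ∑ p ∈ T, g p ≤ C * θ ^ K * T.card + 2 * N * (np * ((2 * (M : ℝ) + 3) ^ d - (2 * ((M : ℝ) - K) + 1) ^ d)) := by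
    rw [← Finset.sum_filter_add_sum_filter_not T (fun p => ((M : ℝ) - K) < ‖p.1‖)]
    have hsh : ∑ p ∈ T.filter (fun p => ((M : ℝ) - K) < ‖p.1‖), g p ≤
        2 * N * (np * ((2 * (M : ℝ) + 3) ^ d - (2 * ((M : ℝ) - K) + 1) ^ d)) := by
      refine (Finset.sum_le_card_nsmul _ _ (2 * (N : ℝ)) fun p _ => min_le_left _ _).trans ?_
      rw [nsmul_eq_mul, mul_comm]
      exact mul_le_mul_of_nonneg_left (card_shallow_le_dim (d := d) hK) (by positivity)
    have hdp : ∑ p ∈ T.filter (fun p => ¬((M : ℝ) - K) < ‖p.1‖), g p ≤ C * θ ^ K * T.card := by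
      refine (Finset.sum_le_card_nsmul _ _ (C * θ ^ K) fun p hp => ?_).trans ?_
      · have h1 : ‖p.1‖ ≤ (M : ℝ) - K := not_lt.1 (Finset.mem_filter.1 hp).2
        have hpK : K ≤ ⌊(M : ℝ) - ‖p.1‖⌋₊ := Nat.le_floor (by linarith)
        exact (min_le_right _ _).trans (mul_le_mul_of_nonneg_left (pow_le_pow_of_le_one hθ0 hθ1 hpK) hC0)
      · rw [nsmul_eq_mul]
        have hc : ((T.filter (fun p => ¬((M : ℝ) - K) < ‖p.1‖)).card : ℝ) ≤ T.card := by
          exact_mod_cast Finset.card_filter_le _ _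
        have : 0 ≤ C * θ ^ K := by positivity
        nlinarith
    linarith
  -- divide by `#T`
  have hkey : |Real.log (∫ ζ, Real.exp (-(N * β) * wilsonBoundaryAction (fundamentalRep (Fin N)) (boxLinks d M)
        (glueWith (boxLinks d M) ζ η)) ∂(Measure.pi fun _ : ↥(boxLinks d M) => haarProbability (SUN N))) -
      (T.card : ℝ) / np * freeEnergyDensity d (fundamentalRep (Fin N)) (N * β)| ≤ N * β * ∑ p ∈ T, g p := hmain
  rw [show Real.log (∫ ζ, Real.exp (-(N * β) * wilsonBoundaryAction (fundamentalRep (Fin N)) (boxLinks d M)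
        (glueWith (boxLinks d M) ζ η)) ∂(Measure.pi fun _ : ↥(boxLinks d M) => haarProbability (SUN N))) / (T.card : ℝ) -
      freeEnergyDensity d (fundamentalRep (Fin N)) (N * β) / np =
      (Real.log (∫ ζ, Real.exp (-(N * β) * wilsonBoundaryAction (fundamentalRep (Fin N)) (boxLinks d M)
        (glueWith (boxLinks d M) ζ η)) ∂(Measure.pi fun _ : ↥(boxLinks d M) => haarProbability (SUN N))) -
      (T.card : ℝ) / np * freeEnergyDensity d (fundamentalRep (Fin N)) (N * β)) / (T.card : ℝ) by field_simp, abs_div,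
    abs_of_pos hTpos, div_le_iff₀ hTpos]
  refine hkey.trans ?_
  have hfrac : 2 * N * (np * ((2 * (M : ℝ) + 3) ^ d - (2 * ((M : ℝ) - K) + 1) ^ d)) ≤
      2 * N * (((2 * (M : ℝ) + 3) ^ d - (2 * ((M : ℝ) - K) + 1) ^ d) / (2 * (M : ℝ) + 1) ^ d) * T.card := by
    have hnn : 0 ≤ (2 * (M : ℝ) + 3) ^ d - (2 * ((M : ℝ) - K) + 1) ^ d := by
      have h1 : (2 * ((M : ℝ) - K) + 1) ≤ 2 * (M : ℝ) + 3 := by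
        have : (0 : ℝ) ≤ K := Nat.cast_nonneg K
        linarith
      have h0 : 0 ≤ 2 * ((M : ℝ) - K) + 1 := by
        have : (K : ℝ) ≤ M := by exact_mod_cast hK
        linarith
      nlinarith [pow_le_pow_left₀ h0 h1 d]
    have hN2 : (0 : ℝ) ≤ 2 * N := by positivity
    rw [← mul_div_assoc, div_mul_eq_mul_div, le_div_iff₀ (by positivity)]
    have := mul_le_mul_of_nonneg_left hTge (mul_nonneg hN2 hnn)
    nlinarith [hTge, hnn, this]
  calc N * β * ∑ p ∈ T, g p ≤ N * β * (C * θ ^ K * T.card + 2 * N * (np * ((2 * (M : ℝ) + 3) ^ d - (2 * ((M : ℝ) - K) + 1) ^ d))) :=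
        mul_le_mul_of_nonneg_left hsplit hNβ
    _ ≤ N * β * (C * θ ^ K * T.card + 2 * N * (((2 * (M : ℝ) + 3) ^ d - (2 * ((M : ℝ) - K) + 1) ^ d) / (2 * (M : ℝ) + 1) ^ d) * T.card) := by
        gcongr
    _ = N * β * (C * θ ^ K + 2 * N * (((2 * (M : ℝ) + 3) ^ d - (2 * ((M : ℝ) - K) + 1) ^ d) / (2 * (M : ℝ) + 1) ^ d)) * (T.card : ℝ) := by
        ring

end BoundaryFreeEnergy

end Summit.Ventures.YMGap.RobustBall

end
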